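/-
Copyright (c) 2026 the pub-hodgecm-mathlib formalisation cell (harness21).  Prover seat hodgecm-mathlib-K2Liu-p03 (g7): Track B «K2-LIT», hLiu418 = stmt-HodgeConjecture-24832,
road `K2_Liu`, socket #42S, organ S4, owner word σ4 (K2E5-plan 11:59:48Z ∕ LEAD BATCH #6): THE FAMILY-LEVEL DET-UNTWIST (converse of ★ `isStandardSectionFamily_detTwist`).
-/
import Summits.HodgeConjecture.HodgeConjecture.Theorems.K2LiuSiegelSectionDetTwist   -- ★ `detChar`, `ratioHecke`, `isStandardSectionFamily_detTwist`, `continuous_coe_detChar`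
import HarnessLib

/-!
# Crux `HLiu418`, road `K2_Liu`, socket #42S, organ S4, σ4: UNTWISTING A STANDARD FAMILY BY `α ∘ det`

Cell `hodgecm-mathlib`, crux item hLiu418 = `stmt-HodgeConjecture-24832`; squad K2 ∕ K2Liu; prover K2Liu-p03 (g7).  THEOREMS ONLY (no `def`, no instance, no notation,
no named-fact hypothesis, no `sorry`); lane `--supports stmt-HodgeConjecture-24832 --as helper`.

The #42S assembler receives `f` standard for `(𝒦, λ̃⁻¹)` with `λ̃⁻¹ = χ_b³ · α̃` (`α̃ = ratioHecke α`, the det-twist equation `_hχD`), while the (asm-3) TOP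
★∕📤 `K2LiuStdSectionCoherentExpansion.exists_coherentExpansion` wants a family standard for `(𝒦, χ_b^{M₂})`.  ★ `isStandardSectionFamily_detTwist` twists
`(𝒦, χ) ↦ (𝒦, χ·α̃)` by `f ↦ (α∘det)·f`; this file UNTWISTS: `(α∘det)⁻¹ · f` is standard for `(𝒦, χ)` when `f` is standard for `(𝒦, χ·α̃)` (apply the ★ twist with `α⁻¹`:
`α̃·(α⁻¹)~ = 1`, `(α⁻¹∘det) = (α∘det)⁻¹`), stays continuous, and `f s h = α(det h) · ((α∘det)⁻¹·f) s h` — so the assembler feeds `(α∘det)⁻¹·f` to the TOP and multiplies back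
(★ (asm-3F) `eq_twistedSum_stdExtension_of_apply_eq_univ` carries the factor `θ := α∘det` through `stdExtension`).
* `ratioHecke_inv_mul_cancel` — `χ · α̃ · (α⁻¹)~ = χ`;  * `coe_detChar_inv_apply` — `(α⁻¹∘det)(h) = (α∘det)(h)⁻¹` in `ℂ`;
* **`isStandardSectionFamily_detUntwist`**, `continuous_detUntwist`, `apply_eq_detChar_mul_detUntwist`.
[KudlaRallis1994, §1]; [HarrisKudlaSweet1996, §1 (1.15)–(1.17)]; [GelbartRogawski1991, §3.1 Remark p. 457].
HONEST LABEL.  Count-neutral helper: `HC_CM` is proved only modulo the 7 printed citations (2 remaining named inputs: hLiu418 = `stmt-HodgeConjecture-24832`,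
h413 = `stmt-HodgeConjecture-24833`) until rung 0 closes.
-/

set_option autoImplicit false
set_option linter.dupNamespace false -- the mandated namespace repeats `HodgeConjecture.HodgeConjecture`

noncomputable section

open NumberField IsDedekindDomain
open Literature.NumberTheory.Automorphic Literature.NumberTheory.Automorphic.UnitaryGroup Literature.NumberTheory.GaloisRepresentations
open Literature.NumberTheory.GelbartRogawski1991 Literature.NumberTheory.GelbartRogawski1991.GRConstruction Literature.NumberTheory.GelbartRogawski1991.UnitaryDualPair
open Literature.NumberTheory.GelbartRogawski1991.GRConstruction.DoubledWeilDetTwist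
open Literature.NumberTheory.K2Lit.SiegelDoubled
open Summit.HodgeConjecture.HodgeConjecture.Cruxes.HLiu418.K2LiuSiegelSectionDetTwist

namespace Summit.HodgeConjecture.HodgeConjecture.Cruxes.HLiu418.K2LiuStdFamilyDetUntwist

variable (L : Type) [Field L] [NumberField L] [IsCMField L]
variable {N M n : ℕ} (e : Fin N × Fin M ≃ Fin n)
  (dV : Fin N → L) (hdV : ∀ i, IsCMField.complexConj L (dV i) = dV i) (hdV0 : ∀ i, dV i ≠ 0)
  (dW : Fin M → L) (hdW : ∀ i, IsCMField.complexConj L (dW i) = dW i) (hdW0 : ∀ i, dW i ≠ 0)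
variable (α : UnitaryGroup.adelicOne (Fp L) L (IsCMField.complexConj L) →* ℂˣ)

/-! ## §1 `α⁻¹`: continuity, automorphy, `α̃ · (α⁻¹)~ = 1`, `(α⁻¹ ∘ det) = (α ∘ det)⁻¹` -/

/-- `α⁻¹` is continuous when `α` is (inversion on `ℂˣ` is continuous). [folklore] -/
theorem continuous_inv_char (hα : Continuous α) : Continuous (α⁻¹ : UnitaryGroup.adelicOne (Fp L) L (IsCMField.complexConj L) →* ℂˣ) := by
  change Continuous fun u => (α⁻¹ : UnitaryGroup.adelicOne (Fp L) L (IsCMField.complexConj L) →* ℂˣ) u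
  simp only [MonoidHom.inv_apply]
  exact hα.inv

/-- `α⁻¹` is automorphic when `α` is. [folklore] -/
theorem inv_char_rat (hαrat : ∀ u : UnitaryGroup.adelicOne (Fp L) L (IsCMField.complexConj L), (u : ideleGroup L) ∈ principalIdeles L → α u = 1) :
    ∀ u : UnitaryGroup.adelicOne (Fp L) L (IsCMField.complexConj L), (u : ideleGroup L) ∈ principalIdeles L →
      (α⁻¹ : UnitaryGroup.adelicOne (Fp L) L (IsCMField.complexConj L) →* ℂˣ) u = 1 := fun u hu => by
  rw [MonoidHom.inv_apply, hαrat u hu, inv_one]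

/-- `χ · α̃ · (α⁻¹)~ = χ` (the Hecke characters `α̃ = ratioHecke α`). [cite: GelbartRogawski1991, §3.1 Remark p. 457 L4–13] -/
theorem ratioHecke_inv_mul_cancel (χ : HeckeCharacter L) (hα : Continuous α)
    (hαrat : ∀ u : UnitaryGroup.adelicOne (Fp L) L (IsCMField.complexConj L), (u : ideleGroup L) ∈ principalIdeles L → α u = 1) :
    χ * ratioHecke L α hα hαrat * ratioHecke L α⁻¹ (continuous_inv_char L α hα) (inv_char_rat L α hαrat) = χ := by
  ext x
  rw [HeckeCharacter.mul_apply, HeckeCharacter.mul_apply, ratioHecke_apply, ratioHecke_apply, MonoidHom.inv_apply, mul_inv_cancel_right]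

include hdV0 hdW0 in
/-- `(α⁻¹ ∘ det)(h) = ((α ∘ det)(h))⁻¹` in `ℂ`. [folklore] -/
theorem coe_detChar_inv_apply (h : HA L e dV hdV dW hdW) :
    ((detChar L e dV hdV hdV0 dW hdW hdW0 α⁻¹ h : ℂˣ) : ℂ) = ((detChar L e dV hdV hdV0 dW hdW hdW0 α h : ℂˣ) : ℂ)⁻¹ := by
  rw [← Units.val_inv_eq_inv_val]
  rfl

/-! ## §2 The untwist -/

include hdV0 hdW0 in
/-- **σ4 — UNTWISTING A STANDARD FAMILY**: if `f` is standard for `(𝒦, χ · α̃)` then `(α∘det)⁻¹ · f` is standard for `(𝒦, χ)` (★ `isStandardSectionFamily_detTwist` with `α⁻¹`,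
`χ·α̃·(α⁻¹)~ = χ`, `(α⁻¹∘det) = (α∘det)⁻¹`). [cite: KudlaRallis1994, §1] [cite: HarrisKudlaSweet1996, §1 (1.15)–(1.17)] -/
theorem isStandardSectionFamily_detUntwist (hα : Continuous α)
    (hαrat : ∀ u : UnitaryGroup.adelicOne (Fp L) L (IsCMField.complexConj L), (u : ideleGroup L) ∈ principalIdeles L → α u = 1)
    {𝒦 : IwasawaDatum L e dV hdV dW hdW} {χ : HeckeCharacter L} {f : ℂ → HA L e dV hdV dW hdW → ℂ}
    (hf : IsStandardSectionFamily 𝒦 (χ * ratioHecke L α hα hαrat) f) :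
    IsStandardSectionFamily 𝒦 χ (fun s h => ((detChar L e dV hdV hdV0 dW hdW hdW0 α h : ℂˣ) : ℂ)⁻¹ * f s h) := by
  have h1 := isStandardSectionFamily_detTwist L e dV hdV hdV0 dW hdW hdW0 α⁻¹ (continuous_inv_char L α hα) (inv_char_rat L α hαrat) hf
  rw [ratioHecke_inv_mul_cancel L α χ hα hαrat] at h1
  have hfun : (fun s h => ((detChar L e dV hdV hdV0 dW hdW hdW0 α⁻¹ h : ℂˣ) : ℂ) * f s h) =
      fun s h => ((detChar L e dV hdV hdV0 dW hdW hdW0 α h : ℂˣ) : ℂ)⁻¹ * f s h :=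
    funext fun s => funext fun h => by rw [coe_detChar_inv_apply]
  rw [hfun] at h1
  exact h1

include hdV0 hdW0 in
/-- the untwisted family is continuous in `h` when `f s` is. [cite: GelbartRogawski1991, §3.1 Remark p. 457 L9–13] -/
theorem continuous_detUntwist (hα : Continuous α) {φ : HA L e dV hdV dW hdW → ℂ} (hφ : Continuous φ) :
    Continuous fun h => ((detChar L e dV hdV hdV0 dW hdW hdW0 α h : ℂˣ) : ℂ)⁻¹ * φ h :=
  ((continuous_coe_detChar L e dV hdV hdV0 dW hdW hdW0 α hα).inv₀ fun _ => Units.ne_zero _).mul hφ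

include hdV0 hdW0 in
/-- `f s h = α(det h) · ((α∘det)⁻¹ · f) s h` — how the assembler multiplies back. [folklore] -/
theorem apply_eq_detChar_mul_detUntwist (f : ℂ → HA L e dV hdV dW hdW → ℂ) (s : ℂ) (h : HA L e dV hdV dW hdW) :
    f s h = ((detChar L e dV hdV hdV0 dW hdW hdW0 α h : ℂˣ) : ℂ) * (((detChar L e dV hdV hdV0 dW hdW hdW0 α h : ℂˣ) : ℂ)⁻¹ * f s h) := by
  rw [← mul_assoc, mul_inv_cancel₀ (Units.ne_zero _), one_mul]

end Summit.HodgeConjecture.HodgeConjecture.Cruxes.HLiu418.K2LiuStdFamilyDetUntwist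

end
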